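import Mathlib
import Summits.NavierStokesRegularity.NavierStokesRegularity.Theorems.FilamentSkeletonRssAreaLawSlavingHoloStadiumAreaOfRealSlip

/-!
# Area-law slaving, complex part 12 — the `StadiumAnalyticArea` conjunct PER FILAMENT, in the crux's letters and scaling
# (`FilamentSkeletonRss`, child crux `TangentSkeletonNearStraight`, stmt-NavierStokesRegularity-28295, line
# `child_tangent_analytic_strip`, ∃-side of the registered stub `stub_analyticClosing`: the `StadiumAnalyticArea` conjunct)

Plug-and-play form of the capstone (complex parts 9–10) for ONE filament of the line's output `TangentSkeletonAnalytic`, with the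
constants chosen in the crux's scaling.  Data: the stadium `S = {|Im z| < cs√Γ, |Re z − c| < Rb√(Γ log Γ) + cs√Γ}` of the line
(`Stadium (cs√Γ) (Rb√(Γ log Γ)) c`); a slip continuation `W` holomorphic on `S`, real on the trace and equal there to the real slip `wj`
(`FlatJ1G`: `w j τ = ⟪v (X j τ), X j′ τ⟫`); `wj c = 0`, `wj′(c) > 3/2` (`FlatJ1G` clause 10); the waist-scale bounds `‖W″‖ ≤ Kw/√Γ`,
`‖W′‖ ≤ M` on `S`; the datum's transversality letter `mw·|x − c| ≤ |wj x|` on the trace (persistence, real parts 8–10); the slaved area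
`Aa` (real part 2): differentiable, area law on `ℝ`, floor `Λ⁻¹ ≤ Aa` (`NearStraightJ1G`).  If the Γ-FREE smallness conditions
  `cs·Kw ≤ 1/8`,   `8·Kw·cs·(18 + 12M + 48Λ) ≤ mw`
hold and the near rectangle fits (`1/(8Kw) < Rb√(log Γ) + cs`, true for `Γ` large), then `StadiumAnalyticArea (cs√Γ) (Rb√(Γ log Γ)) c Aa`
(unfolded).  Choice inside: `r₁ = √Γ/(8Kw)`, `K₂ = Kw/√Γ`, `μ₀ = mw·r₁`, `Amin = Λ⁻¹`.

* `stadium_analytic_area_filament` — the statement above.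

HONEST FRAMING: bookkeeping serving a HYPOTHETICAL filament skeleton on the NEGATIVE side of a MODEL route; no registered stub is closed by
this file and nothing here bears on Navier–Stokes regularity or blow-up.  `--supports stmt-NavierStokesRegularity-28295`.
-/

set_option linter.dupNamespace false

noncomputable section

namespace Summit.NavierStokesRegularity.NavierStokesRegularity.Theorems.AreaLawSlavingHolo

open Set Metric Filter Real
open scoped Topology

/-- **The `StadiumAnalyticArea` conjunct for one filament, crux scaling.**  See the module docstring. [folklore] -/
theorem stadium_analytic_area_filament {Γ cs Rb Λ mw Kw M c : ℝ} (hΓ : 0 < Γ) (hcs : 0 < cs) (hKw : 0 < Kw) (hmw : 0 < mw)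
    (hΛ : 0 < Λ) (hsmall₁ : cs * Kw ≤ 1 / 8) (hsmall₂ : 8 * Kw * cs * (18 + 12 * M + 48 * Λ) ≤ mw)
    (hlen : 1 / (8 * Kw) < Rb * √(Real.log Γ) + cs)
    {W : ℂ → ℂ} (hW : DifferentiableOn ℂ W {z : ℂ | |z.im| < cs * √Γ ∧ |z.re - c| < Rb * √(Γ * Real.log Γ) + cs * √Γ})
    {wj : ℝ → ℝ}
    (htr : ∀ x : ℝ, (x : ℂ) ∈ {z : ℂ | |z.im| < cs * √Γ ∧ |z.re - c| < Rb * √(Γ * Real.log Γ) + cs * √Γ} → (W x).re = wj x)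
    (him : ∀ x : ℝ, (x : ℂ) ∈ {z : ℂ | |z.im| < cs * √Γ ∧ |z.re - c| < Rb * √(Γ * Real.log Γ) + cs * √Γ} → (W x).im = 0)
    (hwc : wj c = 0) (hsup : 3 / 2 < deriv wj c)
    (hK : ∀ ζ ∈ {z : ℂ | |z.im| < cs * √Γ ∧ |z.re - c| < Rb * √(Γ * Real.log Γ) + cs * √Γ}, ‖deriv (deriv W) ζ‖ ≤ Kw / √Γ)
    (hM : ∀ ζ ∈ {z : ℂ | |z.im| < cs * √Γ ∧ |z.re - c| < Rb * √(Γ * Real.log Γ) + cs * √Γ}, ‖deriv W ζ‖ ≤ M)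
    (hfloor : ∀ x : ℝ, (x : ℂ) ∈ {z : ℂ | |z.im| < cs * √Γ ∧ |z.re - c| < Rb * √(Γ * Real.log Γ) + cs * √Γ} →
      mw * |x - c| ≤ |wj x|)
    {Aa : ℝ → ℝ} (hAd : Differentiable ℝ Aa) (hlaw : ∀ τ, wj τ * deriv Aa τ = (3 / 2 - deriv wj τ) * Aa τ + 4)
    (hAfloor : ∀ τ, Λ⁻¹ ≤ Aa τ) :
    ∃ G : ℂ → ℂ, DifferentiableOn ℂ G {z : ℂ | |z.im| < cs * √Γ ∧ |z.re - c| < Rb * √(Γ * Real.log Γ) + cs * √Γ} ∧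
      (∀ t : ℝ, (t : ℂ) ∈ {z : ℂ | |z.im| < cs * √Γ ∧ |z.re - c| < Rb * √(Γ * Real.log Γ) + cs * √Γ} →
        G t = ((Aa t : ℝ) : ℂ)) ∧
      ∀ z ∈ {z : ℂ | |z.im| < cs * √Γ ∧ |z.re - c| < Rb * √(Γ * Real.log Γ) + cs * √Γ},
        Aa z.re / 2 ≤ (G z).re ∧ ‖G z‖ ≤ 2 * Aa z.re := by
  -- the constants
  have hsΓ : 0 < √Γ := Real.sqrt_pos.mpr hΓ
  have hhs : 0 < cs * √Γ := mul_pos hcs hsΓ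
  have hsplit : √(Γ * Real.log Γ) = √Γ * √(Real.log Γ) := Real.sqrt_mul hΓ.le _
  obtain ⟨r₁, hr₁⟩ : ∃ r₁ : ℝ, r₁ = √Γ / (8 * Kw) := ⟨_, rfl⟩
  have hr₁pos : 0 < r₁ := by rw [hr₁]; positivity
  have hUo : IsOpen {z : ℂ | |z.im| < cs * √Γ ∧ |z.re - c| < Rb * √(Γ * Real.log Γ) + cs * √Γ} :=
    thinStadium_isOpen _ _ _
  -- the near rectangle fits: `|c − c| + r₁ < L + hs`
  have hrect : |c - c| + r₁ < Rb * √(Γ * Real.log Γ) + cs * √Γ := by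
    rw [sub_self, abs_zero, zero_add, hr₁, hsplit]
    have h := mul_lt_mul_of_pos_right hlen hsΓ
    calc √Γ / (8 * Kw) = 1 / (8 * Kw) * √Γ := by ring
      _ < (Rb * √(Real.log Γ) + cs) * √Γ := h
      _ = Rb * (√Γ * √(Real.log Γ)) + cs * √Γ := by ring
  have hcU : (c : ℂ) ∈ {z : ℂ | |z.im| < cs * √Γ ∧ |z.re - c| < Rb * √(Γ * Real.log Γ) + cs * √Γ} := by
    refine ⟨by simpa using hhs, ?_⟩
    simp only [Complex.ofReal_re, sub_self, abs_zero]
    have : (0 : ℝ) + r₁ < Rb * √(Γ * Real.log Γ) + cs * √Γ := by simpa using hrect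
    linarith
  -- `W c = 0` and `Re W′(c) > 3/2`
  have hWc : W c = 0 := by
    apply Complex.ext
    · simp [htr c hcU, hwc]
    · simp [him c hcU]
  have hWc_re : 3 / 2 < (deriv W c).re := by
    have h1 : HasDerivAt (fun t : ℝ => (W t).re) (deriv W c).re c :=
      ((hW.differentiableAt (hUo.mem_nhds hcU)).hasDerivAt).real_of_complex
    rw [← h1.deriv, deriv_trace_congr hUo htr hcU]
    exact hsup
  -- near condition `K₂ (r₁ + hs) ≤ 1/4`
  have hK₂r : Kw / √Γ * (r₁ + cs * √Γ) ≤ 1 / 4 := by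
    rw [hr₁]
    have : Kw / √Γ * (√Γ / (8 * Kw) + cs * √Γ) = 1 / 8 + cs * Kw := by
      field_simp
    rw [this]; linarith
  -- the far floor `μ₀ = mw r₁`
  have hfloor' : ∀ x : ℝ, (x : ℂ) ∈ {z : ℂ | |z.im| < cs * √Γ ∧ |z.re - c| < Rb * √(Γ * Real.log Γ) + cs * √Γ} →
      r₁ < |x - c| → mw * r₁ ≤ ‖W x‖ := by
    intro x hx hxr
    have h1 : mw * r₁ ≤ mw * |x - c| := mul_le_mul_of_nonneg_left hxr.le hmw.le
    have h2 : |wj x| ≤ ‖W (x : ℂ)‖ := by rw [← htr x hx]; exact Complex.abs_re_le_norm _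
    linarith [hfloor x hx]
  -- thinness `(18 + 12M + 48/Amin)·hs ≤ μ₀`
  have hthin : (18 + 12 * M + 48 / Λ⁻¹) * (cs * √Γ) ≤ mw * r₁ := by
    rw [hr₁, div_inv_eq_mul]
    have h : (18 + 12 * M + 48 * Λ) * (cs * √Γ) * (8 * Kw) ≤ mw * √Γ := by
      have := mul_le_mul_of_nonneg_right hsmall₂ hsΓ.le
      calc (18 + 12 * M + 48 * Λ) * (cs * √Γ) * (8 * Kw) = 8 * Kw * cs * (18 + 12 * M + 48 * Λ) * √Γ := by ring
        _ ≤ mw * √Γ := this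
    have hmw : mw * (√Γ / (8 * Kw)) = mw * √Γ / (8 * Kw) := by ring
    rw [hmw, le_div_iff₀ (by positivity : (0:ℝ) < 8 * Kw)]
    exact h
  -- the area law on the trace
  exact stadium_analytic_area_of_real_slip (U := {z : ℂ | |z.im| < cs * √Γ ∧ |z.re - c| < Rb * √(Γ * Real.log Γ) + cs * √Γ})
    rfl hr₁pos.le hrect hW htr him hWc hWc_re hK hK₂r hM (mul_pos hmw hr₁pos) hfloor'
    (fun x _ => hAd x) (fun x _ => hlaw x) (inv_pos.mpr hΛ) (fun x _ => hAfloor x) hthin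

end Summit.NavierStokesRegularity.NavierStokesRegularity.Theorems.AreaLawSlavingHolo
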